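import Literature.Probability.Percolation.SusceptibilityPathCounting
import Literature.Probability.Percolation.MeanFieldDelta
import Literature.Probability.Percolation.SusceptibilityGammaOne
import HarnessLib

/-!
# `stub_twoArmSmallLevel` — the two-arm volume sum at the small levels `u ≤ 1/5`, exponent `1`

Crux `Summit.CriticalPhenomena.PercolationContinuityZ3.Theses.PercMinContact.TwoArmWindow`
(item stmt-CriticalPhenomena-11499), line `registered`, registered stub `stub_twoArmSmallLevel` of the
lead's skeleton (`--supports stmt-CriticalPhenomena-11499`).

Statement: there is `C` (namely `6 · 3001 = 18006`) such that for every level `u ≤ 1/5` and every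
`n ≥ 1`,
`Σ_{y ∼ 0} P_u(|C(0)| ≥ n ∧ |C(y)| ≥ n ∧ 0 ↮ y) ≤ C · n^{-1}`.

Proof (every ingredient is PROVED in the tree). Each of the `2 · 3 = 6` terms
(`card_neighborFinset_zdGraph_holds`) is at most `P_u(|C(0)| ≥ n)` (drop the last two conjuncts,
`measureReal_mono`), and by Markov's inequality
`n · P_u(|C(0)| ≥ n) ≤ Σ_{k=1}^{n} P_u(|C(0)| ≥ k) ≤ E_u|C(0)| = Σ_x τ_u(0, x) ≤ 1 + 24 · 5³ = 3001`
for `u ≤ 1/5 = 1/(2d - 1)`, `d = 3` (`mul_real_clusterSizeGe_le_sum`,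
`ofReal_sum_real_clusterSizeGe_le`, `expClusterSize_eq_tsum`, and the path-counting bound
`tsum_tau_le_of_le_inv`: Grimmett 1999 (1.15)–(1.16) with the memory-4 walk count of
Madras–Slade 1993 §1.2).  Finally `(2 · 3) · 3001 / n = 18006 · n^{-1}` (`Real.rpow_neg_one`).
-/

noncomputable section

namespace Summit.CriticalPhenomena.PercolationContinuityZ3.Theorems

open MeasureTheory Literature.Probability.Percolation Literature.Probability.LatticeModels

namespace TwoArmWindowSmallLevel

/-- **`E_u|C(0)| = ofReal (Σ_x τ_u(0,x))` on `ℤ³` for `u ≤ 1/5`**: the mean cluster size is the sum of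
the two-point function (`expClusterSize_eq_tsum`, Tonelli), the real series being convergent at these
levels (`summable_tau_of_le_inv`, `1/5 = 1/(2·3 - 1)`). -/
theorem expClusterSize_eq_ofReal_tsum_tau (u : unitInterval) (hu : (u : ℝ) ≤ 1 / 5) :
    expClusterSize (zdGraph 3) (0 : Site 3) u = ENNReal.ofReal (∑' x, tau 3 u 0 x) := by
  have hu' : (u : ℝ) ≤ 1 / (2 * ((3 : ℕ) : ℝ) - 1) := hu.trans_eq (by norm_num)
  have hs := summable_tau_of_le_inv (d := 3) (by norm_num) u hu'
  rw [expClusterSize_eq_tsum, ENNReal.ofReal_tsum_of_nonneg (fun x => tau_nonneg u 0 x) hs]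
  refine tsum_congr fun x => ?_
  rw [tau_def, ofReal_measureReal]

/-- **`Σ_{k=1}^{n} P_u(|C(0)| ≥ k) ≤ 3001` on `ℤ³` for `u ≤ 1/5`**: the truncated mean `E_u[|C(0)| ∧ n]`
is at most `E_u|C(0)| = Σ_x τ_u(0,x) ≤ 1 + 24 · 5³ = 3001` (`ofReal_sum_real_clusterSizeGe_le` and the
path-counting bound `tsum_tau_le_of_le_inv`). -/
theorem sum_real_clusterSizeGe_le (u : unitInterval) (hu : (u : ℝ) ≤ 1 / 5) (n : ℕ) :
    ∑ k ∈ Finset.Icc 1 n, (bondPercolation (zdGraph 3) u).real (clusterSizeGe (0 : Site 3) k) ≤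
      3001 := by
  have hu' : (u : ℝ) ≤ 1 / (2 * ((3 : ℕ) : ℝ) - 1) := hu.trans_eq (by norm_num)
  have htsum : ∑' x, tau 3 u 0 x ≤ 3001 :=
    (tsum_tau_le_of_le_inv (d := 3) (by norm_num) u hu').trans_eq (by norm_num)
  have h0 : 0 ≤ ∑' x, tau 3 u 0 x := tsum_nonneg fun x => tau_nonneg u 0 x
  have h1 := ofReal_sum_real_clusterSizeGe_le (zdGraph 3) (0 : Site 3) u n
  rw [expClusterSize_eq_ofReal_tsum_tau u hu] at h1
  exact ((ENNReal.ofReal_le_ofReal_iff h0).1 h1).trans htsum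

/-- **`P_u(|C(0)| ≥ n) ≤ 3001 / n` on `ℤ³` for `u ≤ 1/5` and `n ≥ 1`** (Markov's inequality in the form
`n · P_u(|C(0)| ≥ n) ≤ Σ_{k=1}^{n} P_u(|C(0)| ≥ k)`, `mul_real_clusterSizeGe_le_sum`). -/
theorem real_clusterSizeGe_le_div (u : unitInterval) (hu : (u : ℝ) ≤ 1 / 5) (n : ℕ) (hn : 1 ≤ n) :
    (bondPercolation (zdGraph 3) u).real (clusterSizeGe (0 : Site 3) n) ≤ 3001 / n := by
  have hn0 : (0 : ℝ) < n := by exact_mod_cast hn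
  rw [le_div_iff₀ hn0, mul_comm]
  exact (mul_real_clusterSizeGe_le_sum (zdGraph 3) (0 : Site 3) u n).trans
    (sum_real_clusterSizeGe_le u hu n)

/-- **One neighbour.** For every site `y`, every level `u ≤ 1/5` and every `n ≥ 1`,
`P_u(|C(0)| ≥ n ∧ |C(y)| ≥ n ∧ 0 ↮ y) ≤ P_u(|C(0)| ≥ n) ≤ 3001 / n` (keep the first conjunct only). -/
theorem real_twoArm_le_div (u : unitInterval) (hu : (u : ℝ) ≤ 1 / 5) (n : ℕ) (hn : 1 ≤ n)
    (y : Site 3) :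
    (bondPercolation (zdGraph 3) u).real
        {ω | (n : ℕ∞) ≤ (openCluster ω 0).encard ∧ (n : ℕ∞) ≤ (openCluster ω y).encard ∧
          ¬ (openGraph ω).Reachable 0 y} ≤ 3001 / n :=
  (measureReal_mono fun ω hω => show ω ∈ clusterSizeGe (0 : Site 3) n from hω.1).trans
    (real_clusterSizeGe_le_div u hu n hn)

end TwoArmWindowSmallLevel

open TwoArmWindowSmallLevel in
/-- **`stub_twoArmSmallLevel` — SMALL LEVELS, KNOWN.**  There is `C` (namely `6 · 3001 = 18006`) such
that for every level `u ≤ 1/5` and every `n ≥ 1`,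
`Σ_{y ∼ 0} P_u(|C(0)| ≥ n ∧ |C(y)| ≥ n ∧ 0 ↮ y) ≤ C · n^{-1}`: each of the `6` terms is at most
`P_u(|C(0)| ≥ n) ≤ E_u|C(0)|/n ≤ 3001/n` (Markov and `χ(u) = Σ_x τ_u(0,x) ≤ 1 + 24(2d-1)³` for
`u ≤ 1/(2d-1)`, `d = 3`: Grimmett 1999 (1.16) with the memory-4 count of Madras–Slade,
`tsum_tau_le_of_le_inv`). -/
theorem stub_twoArmSmallLevel :
    ∃ C : ℝ, ∀ u : unitInterval, (u : ℝ) ≤ 1 / 5 → ∀ n : ℕ, 1 ≤ n →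
      ∑ y ∈ (zdGraph 3).neighborFinset (0 : Site 3),
        (bondPercolation (zdGraph 3) u).real
          {ω | (n : ℕ∞) ≤ (openCluster ω 0).encard ∧ (n : ℕ∞) ≤ (openCluster ω y).encard ∧
            ¬ (openGraph ω).Reachable 0 y} ≤ C * (n : ℝ) ^ (-(1 : ℝ)) := by
  refine ⟨6 * 3001, fun u hu n hn => ?_⟩
  calc _ ≤ ∑ _y ∈ (zdGraph 3).neighborFinset (0 : Site 3), (3001 : ℝ) / n :=
        Finset.sum_le_sum fun y _ => real_twoArm_le_div u hu n hn y
    _ = 6 * 3001 * (n : ℝ) ^ (-(1 : ℝ)) := by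
        rw [Finset.sum_const, card_neighborFinset_zdGraph_holds (0 : Site 3), nsmul_eq_mul,
          Real.rpow_neg_one]
        push_cast
        ring

end Summit.CriticalPhenomena.PercolationContinuityZ3.Theorems

end
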